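import Mathlib
import HarnessLib
import Literature.Analysis.FluidPDE.TypeIAncientMild
import Literature.Analysis.FluidPDE.LocalTypeI
import Literature.Analysis.FluidPDE.LocalTypeIReverseTools
import Literature.Analysis.FluidPDE.CKNUnforcedOneScaleRRS
import Literature.Analysis.FluidPDE.CKNLocalRegularityRRSStep2
import Literature.Analysis.FluidPDE.CKNLocalRegularityRRSPressure
import Literature.Analysis.FluidPDE.SereginEpsilonRegularityProofs
import Literature.Analysis.FluidPDE.ClassicalTopPointRegularity
import Literature.Analysis.FluidPDE.SpaceTimeRescaling
import Summits.NavierStokesRegularity.NavierStokesRegularity.Theorems.SqueezeCycleExtremalElementExistsRescale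

/-!
# Route SymmetryModuliCount — crux `ForcedSymmetry` (stmt-NavierStokesRegularity-4052),
# line `blow-down-census`: the ε-regularity Liouville theorem in the perturbative-ledger regime

Theorems file serving the registered stub `smallLedger_liouville_of_parts` of the skeleton line
`blow-down-census` for the crux item
`Summit.NavierStokesRegularity.NavierStokesRegularity.Theses.SymmetryModuliCount.ForcedSymmetry`.

Let `A_C` be the Type-I KNSS-mild ancient class (`IsTypeIAncientMild C v`) and fix a Leray-rate
ledger `K`: `∫_{B_R(x₀)} ‖v(t)‖² ≤ K R` for all balls and all `t < 0`. Suppose the class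
`A_C ∩ {ledger K}` carries

* the uniform cubic bound `∫∫_{Q(0,1)} ‖w‖³ ≤ 2CK` (hypothesis `hcubic`), and
* the pressure package (hypothesis `hPress`): every backward time shift `w(· - T)`, `T ∈ (0, 1]`,
  of an element is a suitable weak solution in the unit parabolic ball `Q(0,1)`
  (Albritton–Barker 2019, Def. 2.1) with a pressure `q`, `∫∫_{Q(0,1)} ‖q‖^{3/2} ≤ D₀`,

with `2CK + D₀ ≤ ε := ε₀³`, `ε₀` the constant of the tree's one-scale ε-regularity criterion
`unforced_epsilonRegularity_of_theorem15_3` (Caffarelli–Kohn–Nirenberg's Prop. 1 in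
Lemarié-Rieusset's shape, proved from Robinson–Rodrigo–Sadowski's Thm. 15.3, itself proved from
their Lemma 15.12, `RRS2016.lemma15_12_holds`). Then every `v ∈ A_C` with ledger `K` vanishes
identically.

Proof. Fix `t < 0`, `x`, and a scale `c > 0` with `c² ≥ -t`. The Navier–Stokes zoom
`w = c v(c² ·, x + c ·)` lies in `A_C` with the same ledger (`isTypeIAncientMild_zoom`,
`scaledEnergy_zoom`), and so does its backward shift `V = w(· - T)`, `T = -t/c² ∈ (0, 1]`,
`V(s, y) = c v(t + c² s, x + c y)`. By `hPress`/`hcubic`, `(V, q)` is a suitable weak solution in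
`Q(0,1)` with `∫∫_{Q(0,1)} (‖V‖³ + ‖q‖^{3/2}) ≤ 2CK + D₀ ≤ ε₀³`; the criterion (through the §14.3
classes of the ball solution, `IsSuitableWeakSolutionInBall.exists_isLRSuitableWeakSolutionOn`)
gives `‖V‖ ≤ C₀ ε₀` a.e. on `Q(0, ½)`, hence everywhere there by continuity
(`enorm_le_eLpNorm_top_restrict_of_continuousOn`), in particular `c ‖v(t + c² s, x)‖ ≤ C₀ ε₀`
for `s ∈ (-¼, 0)`; letting `s → 0⁻` (continuity of `v` at `(t, x)`, `t < 0`),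
`c ‖v(t, x)‖ ≤ C₀ ε₀` for every large `c`, so `v(t, x) = 0`.

## References

* L. Caffarelli, R. Kohn, L. Nirenberg, Comm. Pure Appl. Math. 35 (1982), Prop. 1.
  [CaffarelliKohnNirenberg1982]
* J. C. Robinson, J. L. Rodrigo, W. Sadowski, *The three-dimensional Navier–Stokes equations*,
  CUP (2016), Thm. 15.3 (p. 220), Lemma 15.12 (p. 232). [RobinsonRodrigoSadowski2016]
* D. Albritton, T. Barker, J. Math. Fluid Mech. 21 (2019) = arXiv:1811.00502, Def. 2.1, §3.
  [AlbrittonBarker2019]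
* G. Koch, N. Nadirashvili, G. Seregin, V. Šverák, Acta Math. 203 (2009), §1 (scaling), (1.4).
  [KochNadirashviliSereginSverak2009]
-/

noncomputable section

-- the summit and its single problem share the name (D-0017 nested layout)
set_option linter.dupNamespace false

open MeasureTheory Set Metric Filter Function TopologicalSpace
open scoped ENNReal NNReal Topology

namespace Summit.NavierStokesRegularity.NavierStokesRegularity.Theorems.ForcedSymmetry.BlowDownCensus

open Literature.Analysis.FluidPDE
open Summit.NavierStokesRegularity.NavierStokesRegularity.Theorems

/-- **ε-regularity Liouville theorem for the Type-I ancient mild class with a small ledger.**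
There is `ε > 0` (namely `ε₀³`, `ε₀` the constant of the one-scale Caffarelli–Kohn–Nirenberg
criterion `unforced_epsilonRegularity_of_theorem15_3`) such that: if the class
`A_C ∩ {ledger K}` satisfies the uniform cubic bound `∫∫_{Q(0,1)} ‖w‖³ ≤ 2CK` and the pressure
package (every backward shift by `T ∈ (0,1]` of an element is a suitable weak solution in the
parabolic ball `Q(0,1)` with `∫∫_{Q(0,1)} ‖q‖^{3/2} ≤ D₀`), `K, D₀ ≥ 0` and `2CK + D₀ ≤ ε`, then
every `v ∈ A_C` with ledger `K` vanishes on `t < 0` (blow the element down about `(t, x)` at all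
scales `c → ∞`: the blow-downs stay in the class, the criterion bounds them by `C₀ ε₀` on
`Q(0, ½)`, i.e. `c ‖v(t,x)‖ ≤ C₀ ε₀`).
[cite: CaffarelliKohnNirenberg1982, Prop. 1; RobinsonRodrigoSadowski2016 Thm. 15.3 p. 220; AlbrittonBarker2019 Def. 2.1 and §3 (the blow-down)] -/
theorem smallLedger_liouville_of_parts :
    ∃ ε : ℝ, 0 < ε ∧ ∀ (C K D₀ : ℝ),
    (∀ w : ℝ → EuclideanSpace ℝ (Fin 3) → EuclideanSpace ℝ (Fin 3), IsTypeIAncientMild C w →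
      (∀ t < 0, ∀ (x₀ : EuclideanSpace ℝ (Fin 3)) (R : ℝ), 0 < R →
        ∫ x in ball x₀ R, ‖w t x‖ ^ 2 ≤ K * R) →
      ∫⁻ z in parabolicCylinder 1 (0 : ℝ × EuclideanSpace ℝ (Fin 3)), ‖w z.1 z.2‖ₑ ^ (3 : ℕ) ≤
        ENNReal.ofReal (2 * C * K)) →
    (∀ w : ℝ → EuclideanSpace ℝ (Fin 3) → EuclideanSpace ℝ (Fin 3), IsTypeIAncientMild C w →
      (∀ t < 0, ∀ (x₀ : EuclideanSpace ℝ (Fin 3)) (R : ℝ), 0 < R →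
        ∫ x in ball x₀ R, ‖w t x‖ ^ 2 ≤ K * R) →
      ∀ T ∈ Ioc (0 : ℝ) 1, ∃ q : ℝ → EuclideanSpace ℝ (Fin 3) → ℝ,
        IsSuitableWeakSolutionInBall 1 0 (fun s y => w (s - T) y) q ∧
        ∫⁻ z in parabolicCylinder 1 (0 : ℝ × EuclideanSpace ℝ (Fin 3)),
          ‖q z.1 z.2‖ₑ ^ (3 / 2 : ℝ) ≤ ENNReal.ofReal D₀) →
    0 ≤ K → 0 ≤ D₀ → 2 * C * K + D₀ ≤ ε →
    ∀ (v : ℝ → EuclideanSpace ℝ (Fin 3) → EuclideanSpace ℝ (Fin 3)), IsTypeIAncientMild C v →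
      (∀ t < 0, ∀ (x₀ : EuclideanSpace ℝ (Fin 3)) (R : ℝ), 0 < R →
        ∫ x in ball x₀ R, ‖v t x‖ ^ 2 ≤ K * R) →
      ∀ t < 0, ∀ x, v t x = 0 := by
  -- ### the constants of the one-scale ε-regularity criterion
  obtain ⟨ε₀, C₀, hε₀, hC₀, hReg⟩ :=
    unforced_epsilonRegularity_of_theorem15_3
      (RRS2016.theorem15_3_of_lemma15_12 RRS2016.lemma15_12_holds)
  refine ⟨ε₀ ^ 3, pow_pos hε₀ 3, ?_⟩
  intro C K D₀ hcubic hPress hK hD₀ hε v hv hKv t ht x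
  have hC : 0 ≤ C := hv.nonneg
  -- ### the blow-down bound at one scale: `c ‖v t x‖ ≤ C₀ ε₀` whenever `c > 0`, `c² ≥ -t`
  have key : ∀ c : ℝ, 0 < c → -t ≤ c ^ 2 → c * ‖v t x‖ ≤ C₀ * ε₀ := by
    intro c hc hcsq
    -- the shift `T = -t/c² ∈ (0, 1]`
    set T : ℝ := -t / c ^ 2 with hT
    have hT0 : 0 < T := div_pos (by linarith) (pow_pos hc 2)
    have hT1 : T ≤ 1 := (div_le_one (pow_pos hc 2)).2 hcsq
    -- the zoom `w ∈ A_C` and its ledger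
    set w : ℝ → EuclideanSpace ℝ (Fin 3) → EuclideanSpace ℝ (Fin 3) :=
      c • stPull (c ^ 2) c 0 x v with hw
    have hwA : IsTypeIAncientMild C w := isTypeIAncientMild_zoom hv hc x
    have hKw : ∀ s < 0, ∀ (y₀ : EuclideanSpace ℝ (Fin 3)) (R : ℝ), 0 < R →
        ∫ y in ball y₀ R, ‖w s y‖ ^ 2 ≤ K * R := by
      intro s hs y₀ R hR
      have h1 := scaledEnergy_zoom hc x y₀ v s hR
      have hcs : c ^ 2 * s < 0 := mul_neg_of_pos_of_neg (pow_pos hc 2) hs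
      have hcR : 0 < c * R := mul_pos hc hR
      have h2 : ∫ z in ball (x + c • y₀) (c * R), ‖v (c ^ 2 * s) z‖ ^ 2 ≤ K * (c * R) :=
        hKv _ hcs _ _ hcR
      have h3 : R⁻¹ * ∫ y in ball y₀ R, ‖w s y‖ ^ 2 ≤ K := by
        rw [hw, h1]
        calc (c * R)⁻¹ * ∫ z in ball (x + c • y₀) (c * R), ‖v (c ^ 2 * s) z‖ ^ 2
            ≤ (c * R)⁻¹ * (K * (c * R)) := mul_le_mul_of_nonneg_left h2 (inv_nonneg.2 hcR.le)
          _ = K := by rw [mul_comm K, ← mul_assoc, inv_mul_cancel₀ hcR.ne', one_mul]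
      have h4 : ∫ y in ball y₀ R, ‖w s y‖ ^ 2 ≤ R * K := (inv_mul_le_iff₀ hR).1 h3
      linarith [mul_comm R K]
    -- the blow-down `V = w(· - T) = c v(t + c² ·, x + c ·)`
    set V : ℝ → EuclideanSpace ℝ (Fin 3) → EuclideanSpace ℝ (Fin 3) :=
      c • stPull (c ^ 2) c t x v with hV
    have hcT : ∀ s : ℝ, c ^ 2 * (s - T) = t + c ^ 2 * s := fun s => by
      have hc0 : c ≠ 0 := hc.ne'
      simp only [hT]
      field_simp
      ring
    have hVw : (fun s y => w (s - T) y) = V := by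
      funext s y
      simp only [hw, hV, smul_stPull_apply, zero_add, hcT]
    have hVapply : ∀ (s : ℝ) (y : EuclideanSpace ℝ (Fin 3)),
        V s y = c • v (t + c ^ 2 * s) (x + c • y) := fun s y => by
      simp only [hV, smul_stPull_apply]
    have hVA : IsTypeIAncientMild C V := by
      rw [← hVw]; exact hwA.comp_sub_right hT0.le
    have hKV : ∀ s < 0, ∀ (y₀ : EuclideanSpace ℝ (Fin 3)) (R : ℝ), 0 < R →
        ∫ y in ball y₀ R, ‖V s y‖ ^ 2 ≤ K * R := by
      intro s hs y₀ R hR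
      rw [← hVw]
      exact hKw (s - T) (by linarith) y₀ R hR
    -- the pressure and the cubic bound
    obtain ⟨q, hball, hqD⟩ := hPress w hwA hKw T ⟨hT0, hT1⟩
    rw [hVw] at hball
    have hV3 := hcubic V hVA hKV
    -- the §14.3 classes of `(V, q)` on `Ω = Q(0, 1)`
    obtain ⟨G, hS⟩ := hball.exists_isLRSuitableWeakSolutionOn 3
    set O : Opens (ℝ × EuclideanSpace ℝ (Fin 3)) :=
      parabolicCylinderOpens 1 (0 : ℝ × EuclideanSpace ℝ (Fin 3)) with hOdef
    have hsubO : parabolicCylinder 1 (0 : ℝ × EuclideanSpace ℝ (Fin 3)) ⊆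
        (O : Set (ℝ × EuclideanSpace ℝ (Fin 3))) := fun z hz => hz
    have hum : AEMeasurable
        (fun z : ℝ × EuclideanSpace ℝ (Fin 3) => ‖V z.1 z.2‖ₑ ^ (3 : ℕ))
        (volume.restrict (parabolicCylinder 1 (0 : ℝ × EuclideanSpace ℝ (Fin 3)))) :=
      ((hS.distributional.1.aestronglyMeasurable).mono_measure
        (Measure.restrict_mono hsubO le_rfl)).aemeasurable.enorm.pow_const 3
    -- smallness: `∫∫_{Q(0,1)} (‖V‖³ + ‖q‖^{3/2}) ≤ 2CK + D₀ ≤ ε₀³`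
    have hsmall : ∫⁻ z in parabolicCylinder 1 (0 : ℝ × EuclideanSpace ℝ (Fin 3)),
        (‖V z.1 z.2‖ₑ ^ (3 : ℕ) + ‖q z.1 z.2‖ₑ ^ (3 / 2 : ℝ)) ≤
          ENNReal.ofReal (ε₀ ^ 3 * 1 ^ 2) := by
      rw [lintegral_add_left' hum, one_pow, mul_one]
      calc (∫⁻ z in parabolicCylinder 1 (0 : ℝ × EuclideanSpace ℝ (Fin 3)), ‖V z.1 z.2‖ₑ ^ (3 : ℕ)) +
            ∫⁻ z in parabolicCylinder 1 (0 : ℝ × EuclideanSpace ℝ (Fin 3)),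
              ‖q z.1 z.2‖ₑ ^ (3 / 2 : ℝ)
          ≤ ENNReal.ofReal (2 * C * K) + ENNReal.ofReal D₀ := add_le_add hV3 hqD
        _ = ENNReal.ofReal (2 * C * K + D₀) :=
            (ENNReal.ofReal_add (mul_nonneg (mul_nonneg two_pos.le hC) hK) hD₀).symm
        _ ≤ ENNReal.ofReal (ε₀ ^ 3) := ENNReal.ofReal_le_ofReal hε
    -- the criterion: `‖V‖ ≤ C₀ ε₀` a.e. on `Q(0, 1/2)`
    have hae := hReg O 3 V q G (by norm_num) hS 0 1 ε₀ one_pos hsubO hε₀.le le_rfl hsmall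
    have htop : eLpNorm (uncurry V) ∞
        (volume.restrict (parabolicCylinder (1 / 2) (0 : ℝ × EuclideanSpace ℝ (Fin 3)))) ≤
          ENNReal.ofReal (C₀ * ε₀ / 1) := by
      rw [eLpNorm_exponent_top]
      exact eLpNormEssSup_le_of_ae_bound hae
    -- everywhere on `Q(0, 1/2)` by continuity
    have hVcont : ContinuousOn (uncurry V)
        (parabolicCylinder (1 / 2) (0 : ℝ × EuclideanSpace ℝ (Fin 3))) :=
      hVA.continuousOn_uncurry.mono (parabolicCylinder_subset_lowerHalf le_rfl _)
    have hpt : ∀ z ∈ parabolicCylinder (1 / 2) (0 : ℝ × EuclideanSpace ℝ (Fin 3)),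
        ‖V z.1 z.2‖ ≤ C₀ * ε₀ := by
      intro z hz
      have h1 := enorm_le_eLpNorm_top_restrict_of_continuousOn (μ := volume)
        (isOpen_parabolicCylinder _ _) hVcont hz
      have h2 : ‖uncurry V z‖ₑ ≤ ENNReal.ofReal (C₀ * ε₀) := by
        rw [div_one] at htop
        exact h1.trans htop
      rw [← ofReal_norm] at h2
      exact (ENNReal.ofReal_le_ofReal_iff (by positivity)).1 h2
    -- on the time axis: `c ‖v(t + c² s, x)‖ ≤ C₀ ε₀` for `s ∈ (-1/4, 0)`
    have hev : ∀ᶠ s in 𝓝[<] (0 : ℝ), ‖c • v (t + c ^ 2 * s) x‖ ≤ C₀ * ε₀ := by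
      filter_upwards [Ioo_mem_nhdsLT (show (-(1 / 4) : ℝ) < 0 by norm_num)] with s hs
      have hmem : ((s, (0 : EuclideanSpace ℝ (Fin 3))) : ℝ × EuclideanSpace ℝ (Fin 3)) ∈
          parabolicCylinder (1 / 2) (0 : ℝ × EuclideanSpace ℝ (Fin 3)) := by
        rw [mem_parabolicCylinder]
        refine ⟨⟨?_, ?_⟩, ?_⟩
        · show (0 : ℝ) - (1 / 2) ^ 2 < s
          linarith [hs.1]
        · show s < (0 : ℝ)
          exact hs.2
        · show dist (0 : EuclideanSpace ℝ (Fin 3)) 0 < 1 / 2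
          rw [dist_self]
          norm_num
      have h := hpt _ hmem
      rwa [hVapply, smul_zero, add_zero] at h
    -- the limit `s → 0⁻`: `v(·, x)` is continuous at `t < 0`
    have hcont : Tendsto (fun s : ℝ => v (t + c ^ 2 * s) x) (𝓝 0) (𝓝 (v t x)) := by
      have h1 : ContinuousAt (uncurry v) (t, x) :=
        hv.continuousOn_uncurry.continuousAt
          ((isOpen_Iio.prod isOpen_univ).mem_nhds ⟨ht, mem_univ _⟩)
      have h2 : Tendsto (fun s : ℝ => ((t + c ^ 2 * s, x) : ℝ × EuclideanSpace ℝ (Fin 3)))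
          (𝓝 0) (𝓝 (t, x)) := by
        have h3 : Continuous
            (fun s : ℝ => ((t + c ^ 2 * s, x) : ℝ × EuclideanSpace ℝ (Fin 3))) := by
          fun_prop
        have h4 := h3.tendsto 0
        rwa [mul_zero, add_zero] at h4
      exact h1.tendsto.comp h2
    have hlim : Tendsto (fun s : ℝ => ‖c • v (t + c ^ 2 * s) x‖) (𝓝[<] 0)
        (𝓝 ‖c • v t x‖) :=
      ((hcont.const_smul c).norm).mono_left nhdsWithin_le_nhds
    have hle : ‖c • v t x‖ ≤ C₀ * ε₀ := le_of_tendsto hlim hev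
    rwa [norm_smul, Real.norm_of_nonneg hc.le] at hle
  -- ### conclusion: `c → ∞`
  by_contra hne
  have hpos : 0 < ‖v t x‖ := norm_pos_iff.2 hne
  set c : ℝ := Real.sqrt (-t) + (C₀ * ε₀ + 1) / ‖v t x‖ with hc
  have hdiv : 0 ≤ (C₀ * ε₀ + 1) / ‖v t x‖ := div_nonneg (by positivity) hpos.le
  have hc0 : 0 < c := by rw [hc]; positivity
  have hcsq : -t ≤ c ^ 2 := by
    have h1 : Real.sqrt (-t) ≤ c := by rw [hc]; linarith
    calc -t = Real.sqrt (-t) ^ 2 := (Real.sq_sqrt (by linarith)).symm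
      _ ≤ c ^ 2 := pow_le_pow_left₀ (Real.sqrt_nonneg _) h1 2
  have h1 := key c hc0 hcsq
  have h2 : (C₀ * ε₀ + 1) / ‖v t x‖ ≤ c := by rw [hc]; linarith [Real.sqrt_nonneg (-t)]
  have h3 : C₀ * ε₀ + 1 ≤ c * ‖v t x‖ := by
    have h4 := mul_le_mul_of_nonneg_right h2 hpos.le
    rwa [div_mul_cancel₀ _ hpos.ne'] at h4
  linarith

end Summit.NavierStokesRegularity.NavierStokesRegularity.Theorems.ForcedSymmetry.BlowDownCensus

end
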